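import Summits.QuantumFields.BalabanUV.Beta.EriceRemainderEnclosureHistoryAutonomyThresholdDiscreteWitness
import Summits.QuantumFields.BalabanUV.Beta.EriceRemainderEnclosureHistoryAutonomyThresholdMarkov

/-!
# EriceRemainderEnclosureHistoryAutonomyThresholdMarkovExact — (E46d) THE MARKOV PER-GEOMETRY THRESHOLD IS EXACT FOR `bγ² ≥ 9∕7`: at box `1`,
# floor `s ≥ 9∕7`, pin `1`, the set of Lipschitz constants `L` of Markov functionals `u ↦ φ(u 0)` (`φ` `L`-Lipschitz with floor `s` on ]0,1])
# carrying two distinct box solutions IS EXACTLY `]2(1+s)√(1+s), ∞[` — below by (E46c) `memFlow_unique_of_markov_geometry` (every geometry),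
# above by (E46b)'s tent family (witnesses for `s ≥ 9∕7`); so for the MARKOV class the exact threshold is known on `[9∕7, ∞[`, including the
# band `[9∕7, 2[` where (E46a)∕(E46b) decide the MEMORY class only down to `2`

Cell `pub-balaban`, β-function sub-cell, BINDER row D4 «RemainderConst leaves for Bałaban's split» (`HOME/BINDER-OWNERS.md`; owner
lineage `b2b-balaban-beta-an4`; this file by co-owner #2 lineage `b2b-balaban-beta-d4-p2`, generation 41), β-FLOW TEAM duty (1),
FREEZE (0) honoured (def-free; (E46b) `exists_two_solutions_at_geometry` and (E46c) `memFlow_unique_of_markov_geometry` BY NAME).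

HONEST FRAMING (page 1, verbatim and binding).  *"Discharging BetaPertH makes Bałaban's UV stability UNCONDITIONAL — a real
constructive-QFT result; it is NOT the continuum limit and NOT the Clay problem."*  THIS FILE DISCHARGES NOTHING OF THE KIND.  An END over an
explicit toy family and an abstract Markov class; Bałaban's (1.22) is not Markov and nothing of it is asserted.  Row D4 class UNCHANGED
(critical-path width 0; instance 0∕1; D4 DISCHARGE NO DATE).  HONEST DEPENDENCY: continuum YM on T⁴ ⇐ BetaPertH ∧ nine spine estimates (0/9
proved); BetaPertH ⇐ (D1) ∧ (D4) ∧ CAP+tail; G-an2-4 gates asym, D1 and NE2/3/4.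

WHAT IS PROVED ([folklore]; 0 `def`, 0 sorry).  **`markovLipschitzSet_at_geometry_eq_Ioi`** (`9∕7 ≤ s`), `markov_threshold_not_attained`.
-/

noncomputable section
open Filter Topology Finset

namespace Summit.QuantumFields.BalabanUV.Beta.EriceRemainderEnclosureHistoryAutonomyThresholdMarkovExact

open Literature.MathematicalPhysics.QuantumFieldTheory.Balaban1983to89
open Literature.MathematicalPhysics.QuantumFieldTheory.Balaban1983to89.T4BetaStationary
open Literature.MathematicalPhysics.QuantumFieldTheory.Balaban1983to89.T4BetaFlowWellPosed
open Summit.QuantumFields.BalabanUV.Beta.EriceRemainderEnclosureHistoryAutonomyThresholdDiscreteWitness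
open Summit.QuantumFields.BalabanUV.Beta.EriceRemainderEnclosureHistoryAutonomyThresholdMarkov

variable {s : ℝ}

/-- **THE MARKOV PER-GEOMETRY THRESHOLD THEOREM (`bγ² = s ≥ 9∕7`, box `1`, pin `1`).**  The Lipschitz constants of the non-unique Markov
instances with floor `s` are EXACTLY `]2(1+s)√(1+s), ∞[`. [folklore] -/
theorem markovLipschitzSet_at_geometry_eq_Ioi (hs : 9 / 7 ≤ s) :
    {L : ℝ | ∃ (φ : ℝ → ℝ) (h h' : ℕ → ℝ),
      (∀ x x', 0 < x → x ≤ 1 → 0 < x' → x' ≤ 1 → |φ x - φ x'| ≤ L * |x - x'|) ∧ 0 ≤ L ∧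
      (∀ x, 0 < x → x ≤ 1 → s ≤ φ x) ∧ SeqBox 1 h ∧ SeqBox 1 h' ∧
      MemFlow (fun u => φ (u 0)) 1 h ∧ MemFlow (fun u => φ (u 0)) 1 h' ∧ h ≠ h'} = Set.Ioi (2 * ((1 + s) * Real.sqrt (1 + s))) := by
  have hs0 : 0 < s := by linarith
  ext L
  constructor
  · rintro ⟨φ, h, h', hL, hL0, hlo, hh, hh', hf, hf', hne⟩
    rw [Set.mem_Ioi]
    by_contra hle'
    have hle : L * (1 : ℝ) ^ 3 ≤ 2 * ((1 + s * (1 : ℝ) ^ 2) * Real.sqrt (1 + s * (1 : ℝ) ^ 2)) := by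
      simpa using not_lt.1 hle'
    exact hne (memFlow_unique_of_markov_geometry (γ := 1) (b := s) hL hs0 hlo one_pos le_rfl hle hh hh' hf hf')
  · intro hL
    obtain ⟨φ, L', h, h', hL', hL'0, hL'L, hlo, hh, hh', hf, hf', hne⟩ := exists_two_solutions_at_geometry hs (Set.mem_Ioi.1 hL)
    refine ⟨φ, h, h', fun x x' _ _ _ _ => (hL' x x').trans (mul_le_mul_of_nonneg_right hL'L.le (abs_nonneg _)),
      hL'0.trans hL'L.le, fun x _ _ => hlo x, hh, hh', hf, hf', hne⟩

/-- … in particular the threshold value itself carries NO non-unique Markov instance (the set is open at its left end). [folklore] -/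
theorem markov_threshold_not_attained (hs : 9 / 7 ≤ s) :
    (2 * ((1 + s) * Real.sqrt (1 + s))) ∉ {L : ℝ | ∃ (φ : ℝ → ℝ) (h h' : ℕ → ℝ),
      (∀ x x', 0 < x → x ≤ 1 → 0 < x' → x' ≤ 1 → |φ x - φ x'| ≤ L * |x - x'|) ∧ 0 ≤ L ∧
      (∀ x, 0 < x → x ≤ 1 → s ≤ φ x) ∧ SeqBox 1 h ∧ SeqBox 1 h' ∧
      MemFlow (fun u => φ (u 0)) 1 h ∧ MemFlow (fun u => φ (u 0)) 1 h' ∧ h ≠ h'} := by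
  rw [markovLipschitzSet_at_geometry_eq_Ioi hs]
  exact fun hmem => lt_irrefl _ (Set.mem_Ioi.1 hmem)

end Summit.QuantumFields.BalabanUV.Beta.EriceRemainderEnclosureHistoryAutonomyThresholdMarkovExact

end
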